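import Literature.MathematicalPhysics.QuantumFieldTheory.Balaban1983to89.Beta.BiLaplaceBlockKKT
import Literature.MathematicalPhysics.QuantumFieldTheory.Balaban1983to89.Beta.ScalarBlockGreen

/-!
# `Balaban1983to89.Beta.BiLaplaceBlockGreen` — THE BLOCK-CONSTRAINED INVERSE `Sb` OF THE SQUARED LAPLACIAN
(`Beta/BiLaplaceBlockKKT`) IS SYMMETRIC, POSITIVE-SEMIDEFINITE AND CANONICAL: the energy identity
`Sb(x', x'') = ⟨L S_{x'}, L S_{x''}⟩` (`L = codiff₁ ∘ dz`), and uniqueness of tempered solutions of the squared-Laplacian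
KKT system (β sub-cell row BETA-an2, unit `b2b-balaban-beta-an2` gen 6; AN2.md §15.4 brick (G″), second half)

HONEST FRAMING (cell `pub-balaban`, verbatim): discharging `BetaPertH` makes Bałaban's UV stability UNCONDITIONAL — a
real constructive-QFT result; it is NOT the continuum limit and NOT the Clay problem.  This module is [folklore] lattice
analysis on landed machinery; it asserts NOTHING about Bałaban's papers, contains no `def … : Prop` fact, cites
no published theorem as a hypothesis, and is NOT summit progress.  ABSOLUTE RULE honoured: nothing is cited; everything
is proved.

## What is here

For the kernel `Sb x x'` / multiplier `Wb y x'` of `Beta/BiLaplaceBlockKKT` (the tempered solution of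
(EL_b) `L (L λ) = ω ∘ quo N + δ_{x'}`, (M_b) `blockSum N λ = 0` on `ℤ^{d+1}`, at FIXED `N`):

* §1 `lip0` of finite linear combinations (`lip0_sum_left/right`);
* §2 the columns `SbCol x' := Sb(·, x')`, the pulled-back multiplier `WbAdj x'` (block-constant), (EL_b) as
  `lapLapN_SbCol`, (M_b) as `blockSum_SbCol`; uniform bounds and summability of the columns AND of their images
  `L S_{x'}` from the decay;
* §3 the pairings — M/G complementarity `⟨S_{x''}, WbAdj x'⟩ = 0`, `⟨S_{x''}, δ_{x'}⟩ = Sb(x', x'')`, and the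
  adjointness `⟨f, codiff₁ B⟩ = ⟨dz f, B⟩` used twice — giving **THE ENERGY IDENTITY**
  `Sb_eq_lip0 : Sb x' x'' = lip0 (L S_{x'}) (L S_{x''})`, hence `Sb_symm`, `Sb_self_eq`, `Sb_self_nonneg` and **`Sb_psd`**
  (every finite quadratic form in `Sb` is `‖Σ a_b L S_b‖² ≥ 0`);
* §4 the system `SolvesB N F c λ ω`, the identification of the block operator with
  `FibreLiouville.stencilApply (stencil (d+1)) pieceMatrixB` on the block configurations `ScalarBlockGreen.cfgOfS`, and
  **`unique_of_solvesB`** (polynomial Liouville fed by `BiLaplaceBlockKKT.det_trigPolySymbolB_ne_zero`);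
* §5 **`eq_SbCol_of_solvesB`**: `(S_{x'}, W_{x'})` is THE tempered solution with the unit force at `x'` and zero block
  sums — the kernel is canonical, whatever closed formula one prefers for it.

NOT here: strict positivity on fluctuation forces; the projection kernel `L_x L_{x'} Sb`; any `N`-uniform bound; the
READING of `Sb` against the printed scalar operators (AN2.md, markdown only, never cited).
-/

namespace Literature.MathematicalPhysics.QuantumFieldTheory.Balaban1983to89.Beta.BiLaplaceBlockGreen

noncomputable section

open Literature.Probability.LatticeModels (TorusSite Torus.proj Torus.proj_apply)
open AffineAveraging (Form0 Form1 unitVec unitVec_apply dz codiff₁ box toSite blockSum)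
open AffineReproduction (IsBlockConst)
open LatticeForm (repZ quo proj_repZ)
open BlochFibreUniqueness (quo_add_zsmul quo_repZ)
open BlochFibreMatrix (repZ_zero stencil eq_repZ_add_zsmul_quo)
open FibreLiouville (PolyBdd stencilApply eq_of_stencilApply_eq)
open KKTFluctuationEnergy (lip0 lip1 summable_mul_of_bdd summable_mul_of_bdd' summable_of_exp_bound
  abs_le_of_exp_bound summable_dz summable_codiff₁ abs_dz_le abs_codiff₁_le lip0_codiff₁ tsum_mul_eq_zero_of_blockConst
  quo_zsmul_add_toSite)
open KKTFluctuationUnique (ofR0 ofR1 ofR0_apply dz_ofR0 codiff₁_ofR1 blockSum_ofR0 Tempered0 Tempered0.of_bounded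
  abs_le_of_decay510)
open ScalarBlockKKT (IdxS CfgS cfgL cfgW shiftCfgS)
open ScalarBlockGreen (lip1_comm lip0_comm lip0_add δS cfgOfS cfgOfS_inl cfgOfS_inr cfgL_cfgOfS cfgW_cfgOfS
  eq_of_cfgOfS_eq residOfS polyBdd_cfgOfS)
open BiLaplaceBlockKKT (cfgFunB pieceMatrixB cfgFunB_shiftCfgS_eq_sum cfgFunB_shiftCfgS_inl cfgFunB_shiftCfgS_inr
  det_trigPolySymbolB_ne_zero Sb Wb Sb_EL Sb_M decay_Sb decay_wB)
open B12Sec2to5 (l1 l1_nonneg Decay510)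

variable {D d N : ℕ}

/-! ## §1 Toolkit additions: `lip0` of finite linear combinations -/

section Toolkit

/-- `lip0` of a finite linear combination in the first slot, under summability of each pairing. [folklore] -/
theorem lip0_sum_left {ι : Type*} (S : Finset ι) (c : ι → ℝ) (f : ι → Form0 D ℝ) (g : Form0 D ℝ)
    (h : ∀ i ∈ S, Summable (fun x => f i x * g x)) :
    lip0 (fun x => ∑ i ∈ S, c i * f i x) g = ∑ i ∈ S, c i * lip0 (f i) g := by
  unfold lip0
  have e : ∀ x : AffineAveraging.Site D, (∑ i ∈ S, c i * f i x) * g x = ∑ i ∈ S, c i * (f i x * g x) := by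
    intro x
    rw [Finset.sum_mul]
    exact Finset.sum_congr rfl fun i _ => mul_assoc _ _ _
  refine (tsum_congr e).trans ?_
  rw [Summable.tsum_finsetSum (fun i hi => (h i hi).mul_left (c i))]
  exact Finset.sum_congr rfl fun i _ => tsum_mul_left

/-- `lip0` of a finite linear combination in the second slot. [folklore] -/
theorem lip0_sum_right {ι : Type*} (S : Finset ι) (c : ι → ℝ) (f : ι → Form0 D ℝ) (g : Form0 D ℝ)
    (h : ∀ i ∈ S, Summable (fun x => g x * f i x)) :
    lip0 g (fun x => ∑ i ∈ S, c i * f i x) = ∑ i ∈ S, c i * lip0 g (f i) := by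
  rw [lip0_comm, lip0_sum_left S c f g (fun i hi => by
    have h' := h i hi
    simpa only [mul_comm] using h')]
  exact Finset.sum_congr rfl fun i _ => by rw [lip0_comm]

end Toolkit

/-! ## §2 The columns of the kernel and their (EL_b)/(M_b) identities -/

section Columns

variable [NeZero N]

/-- The column `S_{x'} := Sb(·, x')` as a fine 0-form. [folklore] -/
def SbCol (x' : AffineAveraging.Site (d + 1)) : Form0 (d + 1) ℝ := fun z => Sb (N := N) z x'

/-- Its multiplier pulled back to the fine lattice: `x ↦ Wb (quo N x) x'` (block-constant). [folklore] -/
def WbAdj (x' : AffineAveraging.Site (d + 1)) : Form0 (d + 1) ℝ := fun x => Wb (N := N) (quo N x) x'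

/-- (EL_b) for the column, as an identity of 0-forms: `L (L S_{x'}) = WbAdj x' + δ_{x'}`. [folklore] -/
theorem lapLapN_SbCol (x' : AffineAveraging.Site (d + 1)) :
    codiff₁ (dz (codiff₁ (dz (SbCol (N := N) x')))) = WbAdj (N := N) x' + δS x' := by
  funext x
  exact Sb_EL (N := N) x' x

/-- (M_b) for the column: zero block sums. [folklore] -/
theorem blockSum_SbCol (x' y : AffineAveraging.Site (d + 1)) : blockSum N (SbCol (N := N) x') y = 0 :=
  Sb_M (N := N) x' y

/-- Uniform bound and summability of the columns (from `decay_Sb`, at fixed `N`). [folklore] -/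
theorem SbCol_bdd_summable : ∃ C : ℝ, 0 ≤ C ∧ (∀ (x' x : AffineAveraging.Site (d + 1)), |SbCol (N := N) x' x| ≤ C)
    ∧ ∀ (x' : AffineAveraging.Site (d + 1)), Summable (SbCol (N := N) x') := by
  obtain ⟨δ, C, hδ, hC, h⟩ := decay_Sb (N := N) (d := d)
  exact ⟨C, hC, fun x' x => abs_le_of_exp_bound hδ hC x' (fun z => h z x') x,
    fun x' => summable_of_exp_bound hδ x' (fun z => h z x')⟩

/-- Uniform bound and summability of `L S_{x'}`. [folklore] -/
theorem lapN_SbCol_bdd_summable : ∃ C : ℝ, 0 ≤ C ∧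
    (∀ (x' x : AffineAveraging.Site (d + 1)), |codiff₁ (dz (SbCol (N := N) x')) x| ≤ C)
    ∧ ∀ (x' : AffineAveraging.Site (d + 1)), Summable (codiff₁ (dz (SbCol (N := N) x'))) := by
  obtain ⟨C, hC, hbdd, hsum⟩ := SbCol_bdd_summable (N := N) (d := d)
  refine ⟨(d + 1 : ℕ) * (2 * (2 * C)), by positivity, fun x' x => ?_,
    fun x' => summable_codiff₁ (fun κ => summable_dz (hsum x') κ)⟩
  exact abs_codiff₁_le (fun κ z => abs_dz_le (hbdd x') κ z) x

/-- Uniform bound of the pulled-back multipliers (from `decay_wB`). [folklore] -/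
theorem WbAdj_bdd : ∃ C : ℝ, 0 ≤ C ∧ ∀ (x' x : AffineAveraging.Site (d + 1)), |WbAdj (N := N) x' x| ≤ C := by
  obtain ⟨δ, C, hδ, hC, h⟩ := decay_wB (N := N) (d := d)
  refine ⟨C, hC, fun x' x => ?_⟩
  have hz : |WbAdj (N := N) x' x| ≤ C * Real.exp (-δ * l1 (quo N x - quo N x')) :=
    h (Torus.proj N x') (quo N x - quo N x')
  have he : Real.exp (-δ * l1 (quo N x - quo N x')) ≤ 1 := by
    rw [Real.exp_le_one_iff]
    nlinarith [l1_nonneg (quo N x - quo N x')]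
  nlinarith

/-- The pulled-back multiplier is block-constant. [folklore] -/
theorem isBlockConst_WbAdj (x' : AffineAveraging.Site (d + 1)) : IsBlockConst N (WbAdj (N := N) x') := by
  intro y b hb
  have hq0 : quo N (0 : AffineAveraging.Site (d + 1)) = 0 := by
    have := quo_repZ (N := N) (0 : TorusSite (d + 1) N); rwa [repZ_zero] at this
  have hqy : quo N ((N : ℤ) • y) = y := by
    have := quo_add_zsmul (N := N) (0 : AffineAveraging.Site (d + 1)) y
    rwa [zero_add, hq0, zero_add] at this
  simp only [WbAdj]
  rw [quo_zsmul_add_toSite y hb, hqy]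

end Columns

/-! ## §3 The pairings and THE ENERGY IDENTITY `Sb(x', x'') = ⟨L S_{x'}, L S_{x''}⟩` -/

section Energy

variable [NeZero N]

/-- The multiplier term pairs to zero with every column (M/G complementarity). [folklore] -/
theorem lip0_SbCol_WbAdj (x' x'' : AffineAveraging.Site (d + 1)) :
    lip0 (SbCol (N := N) x'') (WbAdj (N := N) x') = 0 := by
  obtain ⟨C, _, _, hsum⟩ := SbCol_bdd_summable (N := N) (d := d)
  obtain ⟨CW, _, hW⟩ := WbAdj_bdd (N := N) (d := d)
  rw [lip0_comm]
  unfold lip0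
  exact tsum_mul_eq_zero_of_blockConst (N := N) (hW x') (isBlockConst_WbAdj (N := N) x') (hsum x'')
    (blockSum_SbCol (N := N) x'')

/-- The force term pairs to the kernel entry: `⟨S_{x''}, δ_{x'}⟩ = Sb(x', x'')`. [folklore] -/
theorem lip0_SbCol_δS (x' x'' : AffineAveraging.Site (d + 1)) :
    lip0 (SbCol (N := N) x'') (δS x') = Sb (N := N) x' x'' := by
  unfold lip0
  have e : ∀ x, SbCol (N := N) x'' x * δS x' x = if x = x' then Sb (N := N) x' x'' else 0 := by
    intro x
    by_cases hx : x = x'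
    · subst hx
      simp [δS, SbCol]
    · simp [δS, hx]
  rw [tsum_congr e, tsum_eq_single x' (fun x hx => if_neg hx), if_pos rfl]

/-- **THE ENERGY IDENTITY.**  `Sb(x', x'') = ⟨L S_{x'}, L S_{x''}⟩_{ℤ^{d+1}}` (`L = codiff₁ ∘ dz`). [folklore] -/
theorem Sb_eq_lip0 (x' x'' : AffineAveraging.Site (d + 1)) :
    Sb (N := N) x' x'' = lip0 (codiff₁ (dz (SbCol (N := N) x'))) (codiff₁ (dz (SbCol (N := N) x''))) := by
  obtain ⟨C, _, hbdd, hsum⟩ := SbCol_bdd_summable (N := N) (d := d)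
  obtain ⟨CL, _, hLbdd, hLsum⟩ := lapN_SbCol_bdd_summable (N := N) (d := d)
  obtain ⟨CW, _, hW⟩ := WbAdj_bdd (N := N) (d := d)
  have s1 : Summable (fun x => SbCol (N := N) x'' x * WbAdj (N := N) x' x) :=
    summable_mul_of_bdd' (hsum x'') (hW x')
  have s2 : Summable (fun x => SbCol (N := N) x'' x * δS x' x) :=
    summable_mul_of_bdd' (M := 1) (hsum x'') (fun x => by
      unfold δS
      split_ifs <;> simp)
  calc Sb (N := N) x' x'' = lip0 (SbCol (N := N) x'') (codiff₁ (dz (codiff₁ (dz (SbCol (N := N) x'))))) := by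
          rw [lapLapN_SbCol, lip0_add s1 s2, lip0_SbCol_WbAdj, lip0_SbCol_δS, zero_add]
    _ = lip1 (dz (SbCol (N := N) x'')) (dz (codiff₁ (dz (SbCol (N := N) x')))) :=
          lip0_codiff₁ (hbdd x'') (fun κ => summable_dz (hLsum x') κ)
    _ = lip1 (dz (codiff₁ (dz (SbCol (N := N) x')))) (dz (SbCol (N := N) x'')) := lip1_comm _ _
    _ = lip0 (codiff₁ (dz (SbCol (N := N) x'))) (codiff₁ (dz (SbCol (N := N) x''))) :=
          (lip0_codiff₁ (hLbdd x') (fun κ => summable_dz (hsum x'') κ)).symm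

/-- **SYMMETRY OF THE KERNEL**: `Sb(x', x'') = Sb(x'', x')`. [folklore] -/
theorem Sb_symm (x' x'' : AffineAveraging.Site (d + 1)) : Sb (N := N) x' x'' = Sb (N := N) x'' x' := by
  rw [Sb_eq_lip0, Sb_eq_lip0, lip0_comm]

/-- The diagonal is an energy: `Sb(x', x') = ∑'_x (L S_{x'} x)²`. [folklore] -/
theorem Sb_self_eq (x' : AffineAveraging.Site (d + 1)) :
    Sb (N := N) x' x' = ∑' x, (codiff₁ (dz (SbCol (N := N) x')) x) ^ 2 := by
  rw [Sb_eq_lip0]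
  unfold lip0
  refine tsum_congr (fun x => ?_)
  ring

/-- **POSITIVITY OF THE DIAGONAL**: `0 ≤ Sb(x', x')`. [folklore] -/
theorem Sb_self_nonneg (x' : AffineAveraging.Site (d + 1)) : 0 ≤ Sb (N := N) x' x' := by
  rw [Sb_self_eq]
  exact tsum_nonneg fun x => sq_nonneg _

/-- A finite linear combination of the `L`-images of columns: `V = ∑_{b ∈ S} a_b L S_b`. [folklore] -/
def lapColSum (S : Finset (AffineAveraging.Site (d + 1))) (a : AffineAveraging.Site (d + 1) → ℝ) : Form0 (d + 1) ℝ :=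
  fun x => ∑ b ∈ S, a b * codiff₁ (dz (SbCol (N := N) b)) x

/-- **POSITIVE-SEMIDEFINITENESS OF THE KERNEL**: every finite quadratic form in `Sb` is `‖∑ a_b L S_b‖² ≥ 0`.
[folklore] -/
theorem Sb_psd (S : Finset (AffineAveraging.Site (d + 1))) (a : AffineAveraging.Site (d + 1) → ℝ) :
    0 ≤ ∑ b ∈ S, ∑ b' ∈ S, a b * a b' * Sb (N := N) b b' := by
  obtain ⟨C, hC, hbdd, hsum⟩ := lapN_SbCol_bdd_summable (N := N) (d := d)
  have hVb : ∀ x, |lapColSum (N := N) S a x| ≤ ∑ b ∈ S, |a b| * C := fun x => by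
    simp only [lapColSum]
    calc |∑ b ∈ S, a b * codiff₁ (dz (SbCol (N := N) b)) x|
        ≤ ∑ b ∈ S, |a b * codiff₁ (dz (SbCol (N := N) b)) x| := Finset.abs_sum_le_sum_abs _ _
      _ ≤ ∑ b ∈ S, |a b| * C := Finset.sum_le_sum fun b _ => by
          rw [abs_mul]
          exact mul_le_mul_of_nonneg_left (hbdd _ x) (abs_nonneg _)
  have hFF : ∀ b b' : AffineAveraging.Site (d + 1),
      Summable (fun x => codiff₁ (dz (SbCol (N := N) b)) x * codiff₁ (dz (SbCol (N := N) b')) x) :=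
    fun b b' => summable_mul_of_bdd (hbdd b) (hsum b')
  have hFV : ∀ b : AffineAveraging.Site (d + 1),
      Summable (fun x => codiff₁ (dz (SbCol (N := N) b)) x * lapColSum (N := N) S a x) :=
    fun b => summable_mul_of_bdd' (hsum b) hVb
  have e1 : ∀ b ∈ S, ∑ b' ∈ S, a b * a b' * Sb (N := N) b b'
      = a b * lip0 (codiff₁ (dz (SbCol (N := N) b))) (lapColSum (N := N) S a) := by
    intro b _
    unfold lapColSum
    rw [lip0_sum_right S a _ _ (fun b' _ => hFF b b'), Finset.mul_sum]
    refine Finset.sum_congr rfl fun b' _ => ?_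
    rw [Sb_eq_lip0]
    ring
  have e2 : ∑ b ∈ S, a b * lip0 (codiff₁ (dz (SbCol (N := N) b))) (lapColSum (N := N) S a)
      = lip0 (lapColSum (N := N) S a) (lapColSum (N := N) S a) := by
    rw [show lapColSum (N := N) S a = fun x => ∑ b ∈ S, a b * codiff₁ (dz (SbCol (N := N) b)) x from rfl]
    exact (lip0_sum_left S a _ _ (fun b _ => hFV b)).symm
  rw [Finset.sum_congr rfl e1, e2]
  exact tsum_nonneg fun x => mul_self_nonneg _

end Energy

/-! ## §4 Tempered uniqueness for the squared-Laplacian system (polynomial Liouville in block coordinates) -/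

/-- THE SQUARED-LAPLACIAN KKT SYSTEM with force `F` and prescribed block sums `c`:
(EL_b) `L (L λ) x = ω (quo N x) + F x`, (M_b) `blockSum N λ y = c y`. [folklore] -/
structure SolvesB (N : ℕ) (F c lam ω : Form0 (d + 1) ℝ) : Prop where
  /-- (EL_b). -/
  el : ∀ x, codiff₁ (dz (codiff₁ (dz lam))) x = ω (quo N x) + F x
  /-- (M_b). -/
  mean : ∀ y, blockSum N lam y = c y

section Residual

variable [NeZero N]

/-- EL rows of the block residual of `cfgOfS λ ω`, from the real fields. [folklore] -/
theorem residB_cfgOfS_inl (lam ω : Form0 (d + 1) ℝ) (y : AffineAveraging.Site (d + 1)) (z : TorusSite (d + 1) N) :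
    cfgFunB (shiftCfgS (cfgOfS (N := N) lam ω) y) (Sum.inl z)
      = (((codiff₁ (dz (codiff₁ (dz lam))) (repZ z + (N : ℤ) • y) - ω y : ℝ)) : ℂ) := by
  rw [cfgFunB_shiftCfgS_inl, cfgL_cfgOfS, cfgW_cfgOfS, dz_ofR0, codiff₁_ofR1, dz_ofR0, codiff₁_ofR1]
  simp only [ofR0_apply]
  push_cast
  ring

/-- M rows of the block residual of `cfgOfS λ ω`. [folklore] -/
theorem residB_cfgOfS_inr (lam ω : Form0 (d + 1) ℝ) (y : AffineAveraging.Site (d + 1)) (u : Unit) :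
    cfgFunB (shiftCfgS (cfgOfS (N := N) lam ω) y) (Sum.inr u) = (((blockSum N lam y : ℝ)) : ℂ) := by
  rw [cfgFunB_shiftCfgS_inr, cfgL_cfgOfS, blockSum_ofR0, ofR0_apply]

/-- The block residual of the configuration of a solution is `residOfS F c`. [folklore] -/
theorem cfgFunB_cfgOfS_of_solvesB {F c lam ω : Form0 (d + 1) ℝ} (h : SolvesB N F c lam ω)
    (y : AffineAveraging.Site (d + 1)) : cfgFunB (shiftCfgS (cfgOfS (N := N) lam ω) y) = residOfS (N := N) F c y := by
  funext i
  rcases i with z | u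
  · rw [residB_cfgOfS_inl, h.el, quo_add_zsmul, quo_repZ, zero_add]
    show _ = ((F (repZ z + (N : ℤ) • y) : ℝ) : ℂ)
    push_cast
    ring
  · rw [residB_cfgOfS_inr, h.mean]
    rfl

/-- In block coordinates the squared-Laplacian KKT operator IS `FibreLiouville.stencilApply (stencil (d+1)) pieceMatrixB`.
[folklore] -/
theorem stencilApply_eq_cfgFunB (U : CfgS (d + 1) N) (y : AffineAveraging.Site (d + 1)) :
    stencilApply (stencil (d + 1)) (pieceMatrixB (N := N)) U y = cfgFunB (shiftCfgS U y) := by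
  rw [cfgFunB_shiftCfgS_eq_sum]
  rfl

end Residual

section Unique

variable [NeZero N]

/-- **UNIQUENESS OF TEMPERED SOLUTIONS OF THE SQUARED-LAPLACIAN SYSTEM**: two tempered pairs solving (EL_b), (M_b) with
the same force and the same block sums are equal. [folklore] -/
theorem unique_of_solvesB {F c lam ω lam' ω' : Form0 (d + 1) ℝ} (h : SolvesB N F c lam ω) (h' : SolvesB N F c lam' ω')
    (hlam : Tempered0 lam) (hω : Tempered0 ω) (hlam' : Tempered0 lam') (hω' : Tempered0 ω') :
    lam = lam' ∧ ω = ω' := by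
  have heq : stencilApply (stencil (d + 1)) (pieceMatrixB (N := N)) (cfgOfS (N := N) lam ω)
      = stencilApply (stencil (d + 1)) (pieceMatrixB (N := N)) (cfgOfS (N := N) lam' ω') := by
    funext y
    rw [stencilApply_eq_cfgFunB, stencilApply_eq_cfgFunB, cfgFunB_cfgOfS_of_solvesB h, cfgFunB_cfgOfS_of_solvesB h']
  exact eq_of_cfgOfS_eq (eq_of_stencilApply_eq _ _ (fun s _ => det_trigPolySymbolB_ne_zero s)
    (polyBdd_cfgOfS hlam hω) (polyBdd_cfgOfS hlam' hω') heq)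

end Unique

/-! ## §5 The kernel is THE tempered solution with a unit force and zero block sums -/

section Canonical

variable [NeZero N]

/-- The coarse multiplier column `y ↦ Wb y x'`. [folklore] -/
def WbCol (x' : AffineAveraging.Site (d + 1)) : Form0 (d + 1) ℝ := fun y => Wb (N := N) y x'

/-- The column `(S_{x'}, W_{x'})` solves the system with the unit force at `x'` and zero block sums. [folklore] -/
theorem solvesB_SbCol (x' : AffineAveraging.Site (d + 1)) : SolvesB N (δS x') 0 (SbCol (N := N) x') (WbCol (N := N) x') where
  el x := Sb_EL (N := N) x' x
  mean y := Sb_M (N := N) x' y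

/-- `S_{x'}` is bounded, hence tempered. [folklore] -/
theorem tempered_SbCol (x' : AffineAveraging.Site (d + 1)) : Tempered0 (SbCol (N := N) x') := by
  obtain ⟨C, _, hbdd, _⟩ := SbCol_bdd_summable (N := N) (d := d)
  exact Tempered0.of_bounded (hbdd x')

/-- `W_{x'}` is bounded, hence tempered. [folklore] -/
theorem tempered_WbCol (x' : AffineAveraging.Site (d + 1)) : Tempered0 (WbCol (N := N) x') := by
  obtain ⟨δ, C, hδ, _, h⟩ := decay_wB (N := N) (d := d)
  refine Tempered0.of_bounded (B := C) fun y => ?_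
  have hb := abs_le_of_decay510 hδ (h (Torus.proj N x')) (y - quo N x')
  exact hb

/-- **THE KERNEL IS CANONICAL**: every TEMPERED pair solving the system with the unit force at `x'` and zero block sums is
`(S_{x'}, W_{x'})`. [folklore] -/
theorem eq_SbCol_of_solvesB {x' : AffineAveraging.Site (d + 1)} {lam ω : Form0 (d + 1) ℝ}
    (h : SolvesB N (δS x') 0 lam ω) (hlam : Tempered0 lam) (hω : Tempered0 ω) :
    lam = SbCol (N := N) x' ∧ ω = WbCol (N := N) x' :=
  unique_of_solvesB h (solvesB_SbCol x') hlam hω (tempered_SbCol x') (tempered_WbCol x')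

/-- In particular the fine field ALONE of any tempered solution is `Sb(·, x')`. [folklore] -/
theorem eq_Sb_of_solvesB {x' : AffineAveraging.Site (d + 1)} {lam ω : Form0 (d + 1) ℝ}
    (h : SolvesB N (δS x') 0 lam ω) (hlam : Tempered0 lam) (hω : Tempered0 ω) (x : AffineAveraging.Site (d + 1)) :
    lam x = Sb (N := N) x x' := by
  rw [(eq_SbCol_of_solvesB h hlam hω).1]
  rfl

end Canonical

end

end Literature.MathematicalPhysics.QuantumFieldTheory.Balaban1983to89.Beta.BiLaplaceBlockGreen
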